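import Literature.AnabelianGeometry.AbsoluteAnabelian.AbsTopIChainsSchemaClosures
import Literature.AnabelianGeometry.AbsoluteAnabelian.AbsTopIChainsKerClauseSchemaNegative
import HarnessLib

/-!
# [AbsTopI] Def 4.2 (iii)/(v): identity operations and constant `Π`-chains — `Chain(Π){A}` has
# objects of every admissible type-chain (proof-only)

S. Mochizuki, *Topics in Absolute Anabelian Geometry I: Generalities* (2012) [AbsTopI] §4, Def 4.2
(iii) (a)–(d) p. 50 and (v) p. 51 (manuscript pagination, lit key `paper:url-11ac98ba15fc`).

Instance forms, at EVERY extension satisfying the inputs of Def 4.2 and every term, for the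
vocabulary rows F-0211 `IsDLocObj`, F-0212 `IsEtLocObj`, F-0217 `TypesAmong` of the abc-iut FACT-LIST
(schema certificate: `AbsTopIChainsSchemaClosures.lean`):

* the identity of a term `Πⱼ` is an elementary operation of type `⋏` (open immersion `Πⱼ ↪ Πⱼ`),
  of type `⋎`, and of type `⊚` (de-orbification by the trivial finite subgroup — the typing does not
  enforce the print proviso "This type of elementary operation is only defined if `X` is a
  hyperbolic orbicurve and `Σ = Primes`" [Def 4.2 (iii) (d), p. 50] nor non-triviality of the finite
  subgroup):
  `ChainGroup.isElemOp_finEtCov_refl`, `isElemOp_finEtQuot_refl`, `isElemOp_deOrb_refl`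
  (abc-iut-L4-t6's `AbsTopII.isElemOp_finEtQuot_self` is the `⋎` case at `Π₀`; the kernel clause of
  the `⊚` case is abc-iut-f-060's `kerTopNormallyGeneratedBy_id_bot`); it is NOT claimed to
  be a de-cuspidalisation (type `•` asks for a kernel normally generated by a non-trivial cuspidal
  decomposition group);
* hence the CONSTANT chain `Π ⇝ Π ⇝ ⋯ ⇝ Π` realises every type-chain avoiding `•`
  (`PiChain.exists_typeChain_eq`), so `ÉtLoc(Π) = Chain(Π){⋏, ⋎}` and `DLoc(Π) = Chain(Π){⋏, •}` have
  objects of every length (`exists_isEtLocObj_len_eq`, `exists_isDLocObj_len_eq`) and, more generally,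
  `Chain(Π){A}` contains a chain of any type-chain drawn from `A ∖ {•}`
  (`exists_typesAmong_typeChain_eq`).

Honest label: these are DEGENERATE objects (all terms equal to `Π₀ = Π`); they witness non-vacuity of
the typed subcategories, nothing about curves.  Proof-only (no `def`); the typer's file is imported,
not edited.  Nothing here bears on [IUTchIII] Cor 3.12; no side is taken.  (Doc v2, 2026-08-27: the
`⊚` proviso of Def 4.2 (iii) (d) is now quoted in full, here and in `isElemOp_deOrb_refl` — the
earlier text dropped the conjunct "X is a hyperbolic orbicurve and" inside the quotation marks without
an ellipsis, referee finding L13-n6; declarations unchanged.)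
-/

noncomputable section

open Topology
open scoped Pointwise

universe u

namespace Literature.AnabelianGeometry.AbsoluteAnabelian

open Literature.AlgebraicGeometry.Frobenioids (IsSlimGroup)

namespace FundamentalExtension

variable {E : FundamentalExtension.{u}}

namespace ChainGroup

/-! ### Identity operations -/

/-- The identity `Πⱼ ↪ Πⱼ` is an elementary operation of type `⋏` (an open immersion compatible with
the rigidifying homomorphisms). [cite: MochizukiAbsTopI2012, Def 4.2 (iii) p.50] -/
theorem isElemOp_finEtCov_refl (C : CuspidalData E) (L : E.ChainGroup) :
    IsElemOp C .finEtCov L L := by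
  refine ⟨ContinuousMonoidHom.id _, fun _ _ h => h, ?_, rigCompat_id L⟩
  rw [show Set.range (ContinuousMonoidHom.id L.grp) = Set.univ from
    Set.range_eq_univ.mpr fun x => ⟨x, rfl⟩]
  exact isOpen_univ

/-- The identity `Πⱼ ↪ Πⱼ` is an elementary operation of type `⋎`.
[cite: MochizukiAbsTopI2012, Def 4.2 (iii) p.50] -/
theorem isElemOp_finEtQuot_refl (C : CuspidalData E) (L : E.ChainGroup) :
    IsElemOp C .finEtQuot L L := by
  refine ⟨ContinuousMonoidHom.id _, fun _ _ h => h, ?_, rigCompat_id L⟩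
  rw [show Set.range (ContinuousMonoidHom.id L.grp) = Set.univ from
    Set.range_eq_univ.mpr fun x => ⟨x, rfl⟩]
  exact isOpen_univ

/-- The identity `Πⱼ ↠ Πⱼ` is an elementary operation of type `⊚` AS TYPED: de-orbification by the
trivial (finite, closed) subgroup of `Δⱼ` (kernel clause: abc-iut-f-060's
`kerTopNormallyGeneratedBy_id_bot`).  (The print's proviso "This type of elementary operation is
only defined if `X` is a hyperbolic orbicurve and `Σ = Primes`" [Def 4.2 (iii) (d), p. 50] and the
intended non-triviality of the finite subgroup are not fields of the typing.)
[cite: MochizukiAbsTopI2012, Def 4.2 (iii) p.50] -/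
theorem isElemOp_deOrb_refl (C : CuspidalData E) (L : E.ChainGroup) : IsElemOp C .deOrb L L := by
  refine ⟨ContinuousMonoidHom.id _, fun x => ⟨x, rfl⟩, rigCompat_id L, ⊥, bot_le, ?_, ?_,
    kerTopNormallyGeneratedBy_id_bot L⟩
  · rw [Subgroup.coe_bot]
    exact Set.finite_singleton 1
  · rw [Subgroup.coe_bot]
    exact isClosed_singleton

/-- Every elementary-operation type other than `•` is realised by the identity of any term.
[cite: MochizukiAbsTopI2012, Def 4.2 (iii) p.50] -/
theorem isElemOp_refl_of_ne_deCusp (C : CuspidalData E) (L : E.ChainGroup) {t : ElemOpType}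
    (ht : t ≠ .deCusp) : IsElemOp C t L L := by
  cases t with
  | finEtCov => exact isElemOp_finEtCov_refl C L
  | finEtQuot => exact isElemOp_finEtQuot_refl C L
  | deCusp => exact absurd rfl ht
  | deOrb => exact isElemOp_deOrb_refl C L

end ChainGroup

/-! ### Constant chains of prescribed type-chain -/

namespace PiChain

variable {C : CuspidalData E} {hP : IsSlimGroup E.arith} {hΔ : IsSlimGroup E.geom} {hne : E.geom ≠ ⊥}

variable (C hP hΔ hne) in
/-- The CONSTANT chain `Π ⇝ Π ⇝ ⋯ ⇝ Π` (every step the identity) realises every type-chain that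
avoids `•`: for such `τ` there is a `Π`-chain with `typeChain = τ` all of whose terms are `Π₀ = Π`.
[cite: MochizukiAbsTopI2012, Def 4.2 (iii) p.49] -/
theorem exists_typeChain_eq (τ : List ElemOpType) (hτ : ElemOpType.deCusp ∉ τ) :
    ∃ c : E.PiChain C hP hΔ hne, c.typeChain = τ ∧ ∀ j, c.term j = ChainGroup.self hP hΔ hne := by
  let c : E.PiChain C hP hΔ hne :=
    { len := τ.length
      term := fun _ => ChainGroup.self hP hΔ hne
      term_zero := rfl
      types := fun j => τ.get j
      isElemOp := fun j => ChainGroup.isElemOp_refl_of_ne_deCusp C _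
        (fun h => hτ (h ▸ List.get_mem τ j)) }
  exact ⟨c, List.ofFn_get τ, fun _ => rfl⟩

variable (C hP hΔ hne) in
/-- `Chain(Π){A}` contains a chain of EVERY type-chain drawn from `A ∖ {•}` ([AbsTopI] Def 4.2 (v):
the subcategories are non-vacuous in every length as soon as `A ⊄ {•}`).
[cite: MochizukiAbsTopI2012, Def 4.2 (v) p.51] -/
theorem exists_typesAmong_typeChain_eq (A : Set ElemOpType) (τ : List ElemOpType)
    (hA : ∀ t ∈ τ, t ∈ A) (hτ : ElemOpType.deCusp ∉ τ) :
    ∃ c : E.PiChain C hP hΔ hne, c.TypesAmong A ∧ c.typeChain = τ := by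
  obtain ⟨c, hc, -⟩ := exists_typeChain_eq C hP hΔ hne τ hτ
  refine ⟨c, (typesAmong_iff_forall_mem_typeChain c A).2 ?_, hc⟩
  rw [hc]
  exact hA

variable (C hP hΔ hne) in
/-- `ÉtLoc(Π) = Chain^{iso-trm}(Π){⋏, ⋎}` has objects of every length (the constant chain of type
`⋏⋏⋯⋏`). [cite: MochizukiAbsTopI2012, Def 4.2 (v) p.51] -/
theorem exists_isEtLocObj_len_eq (n : ℕ) : ∃ c : E.PiChain C hP hΔ hne, c.IsEtLocObj ∧ c.len = n := by
  obtain ⟨c, hc, hτ⟩ := exists_typesAmong_typeChain_eq C hP hΔ hne {.finEtCov, .finEtQuot}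
    (List.replicate n .finEtCov) (fun t ht => by
      rw [List.eq_of_mem_replicate ht]
      exact Or.inl rfl) (fun h => by
      have := List.eq_of_mem_replicate h
      exact ElemOpType.noConfusion this)
  refine ⟨c, hc, ?_⟩
  have hlen := congrArg List.length hτ
  rwa [PiChain.typeChain, List.length_ofFn, List.length_replicate] at hlen

variable (C hP hΔ hne) in
/-- `DLoc(Π) = Chain^{trm}(Π){⋏, •}` has objects of every length (the constant chain of type
`⋏⋏⋯⋏`). [cite: MochizukiAbsTopI2012, Def 4.2 (v) p.51] -/
theorem exists_isDLocObj_len_eq (n : ℕ) : ∃ c : E.PiChain C hP hΔ hne, c.IsDLocObj ∧ c.len = n := by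
  obtain ⟨c, hc, hτ⟩ := exists_typesAmong_typeChain_eq C hP hΔ hne {.finEtCov, .deCusp}
    (List.replicate n .finEtCov) (fun t ht => by
      rw [List.eq_of_mem_replicate ht]
      exact Or.inl rfl) (fun h => by
      have := List.eq_of_mem_replicate h
      exact ElemOpType.noConfusion this)
  refine ⟨c, hc, ?_⟩
  have hlen := congrArg List.length hτ
  rwa [PiChain.typeChain, List.length_ofFn, List.length_replicate] at hlen

end PiChain

end FundamentalExtension

end Literature.AnabelianGeometry.AbsoluteAnabelian

end
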